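import Literature.NumberTheory.EllipticCurves.Kato2004.FineSelmerDualDescentLengthProofs
import Literature.NumberTheory.EllipticCurves.Kato2004.IwasawaCohomology
import Literature.NumberTheory.EllipticCurves.BSDSelmerPConverseHeegnerMainConjectureProofs
import Literature.NumberTheory.GaloisRepresentations.ContinuousH1AddHomAlgebraProofs
import HarnessLib

/-!
# Kato 2004 (Astérisque 295) §14.14 (14.14.1) at the prime `(T)`, CONVERSE COUNT: `ℓ_T(X₀(E/ℚ_∞)) ≤ 1`
# forces `rank_{ℤ_p} H¹(ℤ[1/p], T_pW) ≤ 2` (proofs only)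

Topic `NumberTheory/EllipticCurves`, sub-directory `Kato2004` (namespace = path). THEOREMS ONLY (no
definition, no named fact, no `instance`, no notation, no `sorry`). Companion of
`FineSelmerDualDescentLengthProofs.lean` (the descent count `ℓ_T(T·X₀) = 0 ∧ rank ≤ 2 ⇒ ℓ_T(X₀) ≤ 1`);
prover seat `bsd-line-dkd-p1` g1 (LEAD of crux stmt-BirchSwinnertonDyer-23259, line `descent`). This file
is the NECESSITY half for the line's open stub S2: modulo the displayed facts
`exists_iwasawaH2Data_fineSelmerDual_embedding` (Kato (14.9.1): `X₀ ↪ 𝐇²_Γ` with FINITE cokernel) and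
`thm12_4` (Kato Thm. 12.4 (3): `𝐇¹_Γ` free of rank one), `ℓ_T(X₀) ≤ 1` implies
`rank_{ℤ_p} H¹(ℤ[1/p], T_pW) ≤ 2` at an odd good ordinary prime with `E[p]` irreducible. With the sibling
file this shows that the line's two open stubs (`T`-semisimplicity of `X₀`; `rank ≤ 2`) carry no content
beyond the crux modulo print. HONEST FRAMING: nothing about BSD or the main conjecture is asserted.

## What is proved

* `IwasawaAlgebra.lengthAt_coinvariants_eq_one_of_free_of_finrank_eq_one`: `ℓ_T(H/TH) = 1` for `H ≅ Λ`;
* `IwasawaAlgebra.lengthAt_invariants_le_of_injective_of_finite_coker`: `ℓ_T(N[T]) ≤ ℓ_T(M[T])` for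
  `M ↪ N` with finite cokernel (left exactness of `(·)[T]`, finite modules have `ℓ_T = 0`);
* `Kato2004.exists_layerZeroToTop_eq_of_mem_integralH1`: `layerZeroToTop` maps the integral classes at the
  bottom layer ONTO `integralH1 (tateRep W p) p ⊤` (restriction along `κ.layerSubgroup 0 ≤ ⊤` is a right
  inverse);
* `Kato2004.IwasawaH2Data.toENat_rank_integralH1_eq_lengthAt_A`: on a descent package,
  **`rank_{ℤ_p} H¹(ℤ[1/p], T_pW) = ℓ_T(A)`** (the pin `layerZeroToTop ∘ toH1` is a `ℤ_p`-linear bijection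
  `A ≅ integralH1 … ⊤`, and `T` acts as `0` on `A`);
* **`WeierstrassCurve.rank_integralH1_le_two_of_fineSelmerDual_lengthAt_le_one`** (the converse count):
  `rank A = ℓ_T(𝐇¹/T𝐇¹) + ℓ_T(𝐇²[T]) ≤ 1 + ℓ_T(X₀[T]) ≤ 1 + ℓ_T(X₀) ≤ 2`.

## References

* K. Kato, Astérisque 295 (2004): §8.2 / Lemma 8.5 (pp. 180–184), Thm. 12.4 (p. 221), (14.9.1) (p. 239),
  §14.14 (14.14.1) (p. 243). [Kato2004Asterisque]
* L. Washington, *Introduction to Cyclotomic Fields*, §13.2. [Washington1997]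
* J.-P. Serre, *Galois Cohomology*, I §2.4 (restriction). [SerreGaloisCohomology1997]
* Tree: `Kato2004/FineSelmerDualDescentLengthProofs.lean`, `Kato2004/IwasawaH2Descent.lean`,
  `Kato2004/LocPKernelRankOnePlumbing.lean`, `GaloisRepresentations/ContinuousH1AddHomAlgebraProofs.lean`
  (`resLe_resLe_apply`, `resLe_refl_apply`), `IwasawaEulerCharProofs.lean`.
-/

noncomputable section

open scoped NumberField
open Field IsDedekindDomain
open Literature.NumberTheory.GaloisRepresentations
open Literature.NumberTheory.EllipticCurves Literature.NumberTheory.EllipticCurves.IwasawaAlgebra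
open Literature.NumberTheory.EllipticCurves.Kato2004.EulerSystemValues

namespace Literature.NumberTheory.EllipticCurves

namespace IwasawaAlgebra

variable {p : ℕ} [Fact p.Prime]

/-- **`ℓ_T(H/TH) = 1` for `H` free of rank one over `Λ`** (`H ≅ Λ`, `Λ/TΛ = Λ/𝔭_T` has length one at
`𝔭_T`). [cite: Washington1997, §13.2] -/
theorem lengthAt_coinvariants_eq_one_of_free_of_finrank_eq_one {H : Type*} [AddCommGroup H]
    [Module (IwasawaAlgebra p) H] [Module.Free (IwasawaAlgebra p) H]
    (hrank : Module.finrank (IwasawaAlgebra p) H = 1) :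
    Module.lengthAt (IwasawaAlgebra p) (coinvariants p H) (primeT p) = 1 := by
  let e : H ≃ₗ[IwasawaAlgebra p] IwasawaAlgebra p :=
    (Module.basisUnique (Fin 1) hrank).repr.trans
      (Finsupp.uniqueLinearEquiv (IwasawaAlgebra p) (IwasawaAlgebra p) (0 : Fin 1))
  rw [Module.lengthAt_eq_of_linearEquiv (coinvariantsEquiv e) (primeT p)]
  exact lengthAt_coinvariants_self p

/-- **`ℓ_T(N[T]) ≤ ℓ_T(M[T])` for an injective `Λ`-linear `M → N` with FINITE cokernel** (left exactness
of `(·)[T]` on `0 → M → N → N/M → 0`, and `ℓ_T` of a finite module is `0`). [cite: Washington1997, §13.2] -/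
theorem lengthAt_invariants_le_of_injective_of_finite_coker {M N : Type*} [AddCommGroup M]
    [Module (IwasawaAlgebra p) M] [AddCommGroup N] [Module (IwasawaAlgebra p) N]
    (e : M →ₗ[IwasawaAlgebra p] N) (he : Function.Injective e)
    (hfin : Finite (N ⧸ LinearMap.range e)) :
    Module.lengthAt (IwasawaAlgebra p) ↥(invariants p N) (primeT p) ≤
      Module.lengthAt (IwasawaAlgebra p) ↥(invariants p M) (primeT p) := by
  haveI := hfin
  haveI : Finite ↥(invariants p (N ⧸ LinearMap.range e)) := Subtype.finite
  have hex := exact_invariantsMap e (LinearMap.range e).mkQ he (LinearMap.exact_map_mkQ_range e)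
  have h := Module.lengthAt_le_add_of_exact _ _ hex (primeT p)
  rwa [lengthAt_primeT_eq_zero_of_finite p ↥(invariants p (N ⧸ LinearMap.range e)), add_zero] at h

end IwasawaAlgebra

namespace Kato2004

variable {W : WeierstrassCurve ℚ} [W.IsElliptic] {p : ℕ} [Fact p.Prime]
  [ContinuousSMul ℤ_[p] (W.tateModule p)] {κ : ZpExtension ℚ p} {γ : absoluteGaloisGroup ℚ}

/-- `layerZeroToTop` hits every integral class at `⊤`: restriction along `κ.layerSubgroup 0 ≤ ⊤` is a
right inverse (both subgroups are all of `Γ_ℚ`), and it preserves integrality (the restrictions to the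
inertia subgroups factor through it). [cite: Kato2004Asterisque, §8.2 and Lemma 8.5 (pp. 180–184)] -/
theorem exists_layerZeroToTop_eq_of_mem_integralH1 (κ : ZpExtension ℚ p)
    {x : H1 (tateRep W p) ⊤} (hx : x ∈ integralH1 (tateRep W p) p ⊤) :
    ∃ y : H1 (tateRep W p) (κ.layerSubgroup 0),
      y ∈ integralH1 (tateRep W p) p (κ.layerSubgroup 0) ∧ layerZeroToTop W p κ y = x := by
  refine ⟨resLe (tateRep W p).toTopRep (le_top : κ.layerSubgroup 0 ≤ ⊤) 1 x, ?_, ?_⟩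
  · rw [mem_integralH1_iff] at hx ⊢
    intro v hv 𝔓 h𝔓
    have h1 : κ.layerSubgroup 0 ⊓ 𝔓.inertia (absoluteGaloisGroup ℚ) ≤
        (⊤ : Subgroup (absoluteGaloisGroup ℚ)) ⊓ 𝔓.inertia (absoluteGaloisGroup ℚ) :=
      fun g hg => ⟨trivial, hg.2⟩
    rw [resLe_resLe_apply, ← resLe_resLe_apply (tateRep W p).toTopRep h1 inf_le_left, hx v hv 𝔓 h𝔓,
      map_zero]
  · unfold layerZeroToTop
    rw [resLe_resLe_apply]
    exact resLe_refl_apply (tateRep W p).toTopRep x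

/-- **On a descent package, `rank_{ℤ_p} H¹(ℤ[1/p], T_pW) = rank_{ℤ_p} A`** — read in `ℕ∞`: the pin
`layerZeroToTop ∘ toH1 : A → integralH1 (tateRep W p) p ⊤` is a `ℤ_p`-linear BIJECTION (injective by the
pin, surjective by `exists_layerZeroToTop_eq_of_mem_integralH1` and `mem_range_toH1_iff`), and
`ℓ_T(A) = rank_{ℤ_p} A` (`T` acts as `0` on `A`).
[cite: Kato2004Asterisque, §8.2 and Lemma 8.5 (pp. 180–184), §14.14 (p. 243)] -/
theorem IwasawaH2Data.toENat_rank_integralH1_eq_lengthAt_A {I : IwasawaH1Data W p κ γ}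
    (J : IwasawaH2Data W p κ γ I) :
    Cardinal.toENat (Module.rank ℤ_[p] ↥(integralH1 (tateRep W p) p ⊤)) =
      Module.lengthAt (IwasawaAlgebra p) J.A (primeT p) := by
  letI : Module ℤ_[p] J.A := Module.compHom J.A (algebraMap ℤ_[p] (IwasawaAlgebra p))
  haveI : IsScalarTower ℤ_[p] (IwasawaAlgebra p) J.A :=
    IsScalarTower.of_algebraMap_smul fun _ _ => rfl
  have hA : Module.lengthAt (IwasawaAlgebra p) J.A (primeT p) = Cardinal.toENat (Module.rank ℤ_[p] J.A) :=
    lengthAt_eq_toENat_rank_of_X_smul_eq_zero p J.X_smul_eq_zero (primeT p) (primeT_asIdeal p)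
  let f : J.A →ₗ[ℤ_[p]] ↥(integralH1 (tateRep W p) p ⊤) :=
    { toFun := fun a => ⟨layerZeroToTop W p κ (J.toH1 a),
        layerZeroToTop_mem_integralH1 W p κ (J.toH1_mem a)⟩
      map_add' := fun a b => Subtype.ext (by
        simp only [map_add, Submodule.coe_add])
      map_smul' := fun c a => Subtype.ext (by
        simp only [RingHom.id_apply, Submodule.coe_smul]
        rw [← layerZeroToTop_smul]
        congr 1
        change J.toH1 ((algebraMap ℤ_[p] (IwasawaAlgebra p) c) • a) = c • J.toH1 a
        rw [J.toH1_smul, PowerSeries.algebraMap_eq, PowerSeries.constantCoeff_C]) }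
  have hf : Function.Injective f := by
    intro a b hab
    have h1 : layerZeroToTop W p κ (J.toH1 a) = layerZeroToTop W p κ (J.toH1 b) :=
      congrArg Subtype.val hab
    have h2 : J.toH1 a = J.toH1 b := by
      rw [← sub_eq_zero] at h1 ⊢
      rw [← map_sub] at h1
      exact eq_zero_of_layerZeroToTop_eq_zero W p κ _ h1
    exact J.toH1_injective h2
  have hfs : Function.Surjective f := by
    rintro ⟨x, hx⟩
    obtain ⟨y, hy, hyx⟩ := exists_layerZeroToTop_eq_of_mem_integralH1 κ hx
    obtain ⟨a, ha⟩ := J.exists_eq_toH1_of_mem hy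
    exact ⟨a, Subtype.ext (by simp only [f, LinearMap.coe_mk, AddHom.coe_mk, ha, hyx])⟩
  rw [hA, (LinearEquiv.ofBijective f ⟨hf, hfs⟩).rank_eq]

end Kato2004

/-! ## The converse count -/

open Kato2004 in
/-- **Converse count (necessity of «`rank_{ℤ_p} H¹(ℤ[1/p], T_pW) ≤ 2`»):** at an odd good ordinary prime
with `E[p]` irreducible, along a cyclotomic datum, `ℓ_T(X₀(E/ℚ_∞)) ≤ 1` forces
`rank_{ℤ_p} H¹(ℤ[1/p], T_pW) ≤ 2` — modulo the displayed facts `hPT` (Kato (14.9.1), embedding with FINITE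
cokernel) and `h124` (Kato Thm. 12.4 (3): `𝐇¹` free of rank one, so `ℓ_T(𝐇¹/T𝐇¹) = 1`):
`rank A = ℓ_T(A) = ℓ_T(𝐇¹/T𝐇¹) + ℓ_T(𝐇²[T]) ≤ 1 + ℓ_T(X₀[T]) ≤ 1 + ℓ_T(X₀) ≤ 2`.
[cite: Kato2004Asterisque, §14.14 (14.14.1) (p. 243), (14.9.1) (p. 239), Thm. 12.4 (3) (p. 221)] -/
theorem _root_.WeierstrassCurve.rank_integralH1_le_two_of_fineSelmerDual_lengthAt_le_one
    (W : WeierstrassCurve ℚ) [W.IsElliptic] [W.IsGloballyMinimal] {p : ℕ} [Fact p.Prime]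
    [ContinuousSMul ℤ_[p] (W.tateModule p)] {κ : ZpExtension ℚ p} {γ : absoluteGaloisGroup ℚ}
    (hPT : exists_iwasawaH2Data_fineSelmerDual_embedding) (h124 : thm12_4)
    (hp : p ≠ 2) (hgood : W.HasGoodReductionAtPrime p) (hord : ¬ (p : ℤ) ∣ W.frobeniusTrace p)
    (hirr : W.HasIrreducibleModPGaloisRep p) (hκ : κ.IsCyclotomic) (hγ : κ.IsTopGenerator γ)
    (hX : Module.lengthAt (IwasawaAlgebra p) (W.fineSelmerDualData κ hγ).X (primeT p) ≤ 1) :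
    Module.rank ℤ_[p] ↥(integralH1 (tateRep W p) p ⊤) ≤ 2 := by
  obtain ⟨I⟩ := nonempty_iwasawaH1Data_holds W p κ γ hκ hγ
  obtain ⟨J, e, he, hfin⟩ :=
    exists_iwasawaH2Data_fineSelmerDual_embedding_of_goodOrdinary hPT hp hgood hord hκ hγ I
  -- `ℓ_T(𝐇²[T]) ≤ ℓ_T(X₀[T]) ≤ ℓ_T(X₀) ≤ 1`
  have hH2 : Module.lengthAt (IwasawaAlgebra p) ↥(invariants p J.H2) (primeT p) ≤ 1 :=
    (IwasawaAlgebra.lengthAt_invariants_le_of_injective_of_finite_coker e he hfin).trans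
      ((Module.lengthAt_submodule_le _ (primeT p)).trans hX)
  -- `ℓ_T(𝐇¹/T𝐇¹) = 1`
  obtain ⟨hfree, hrank⟩ := (h124 W p κ γ hκ hγ I).2.2 hp hirr
  haveI := hfree
  have h1 : Module.lengthAt (IwasawaAlgebra p) (coinvariants p I.H) (primeT p) = 1 :=
    IwasawaAlgebra.lengthAt_coinvariants_eq_one_of_free_of_finrank_eq_one hrank
  -- `rank A = ℓ_T(A) = 1 + ℓ_T(𝐇²[T]) ≤ 2`
  have hA : Module.lengthAt (IwasawaAlgebra p) J.A (primeT p) ≤ 2 := by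
    rw [J.lengthAt_A_eq_coinvariants_add_invariants, h1]
    calc (1 : ℕ∞) + Module.lengthAt (IwasawaAlgebra p) ↥(invariants p J.H2) (primeT p)
        ≤ 1 + 1 := add_le_add le_rfl hH2
      _ = 2 := by norm_num
  have h := J.toENat_rank_integralH1_eq_lengthAt_A
  exact Cardinal.toENat_le_ofNat.mp (h ▸ hA)

end Literature.NumberTheory.EllipticCurves

end
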